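import Summits.BirchSwinnertonDyer.Rank1Residual.X1.RankOne
import Summits.BirchSwinnertonDyer.Rank1Residual.X1.PadicSigmaThreeConsequences
import Literature.NumberTheory.EllipticCurves.PAdicLFunctionOrderParityProofs
import Literature.NumberTheory.EllipticCurves.CuspFormLFunctionLevelConductorProofs
import HarnessLib

/-!
# The PARITY-SQUEEZED Schneider certificate at EVERY rank-one good ordinary pair (rung I1 = the
# Schneider rider, README row C1): `[T²] L_p(f,α,T) ≠ 0 ⇒` THE canonical `p`-adic height is non-degenerate;
# equivalently, a degenerate canonical height forces `ord_{T=0} L_p(f,α,T) ≥ 3`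

Support file (prover seat `bsd-schneider-i1-c2`, gen 4, cell `bsd-schneider-ideate`; `--supports
stmt-BirchSwinnertonDyer-19086`): the CLASS-FREE form of §§1–3 of the companion file
`Theorems/SlopeDichotomyA2DegenerateLocusA2OrderParity.lean` (which states them on corner A2 =
`X1.TypeBRankOne`, the locus of item 19086). Nothing here refers to class X1: the hypotheses are a
globally minimal elliptic `W/ℚ`, an ODD prime `p` of good ORDINARY reduction, and `ord_{s=1} L(E,s) = 1` —
i.e. every pair on the cyclotomic rank-one roads that carry the Schneider rider at a good prime (README
rows A1/A2 = X1 r = 1 both Greenberg–Vatsal types, A4/A5 r = 1, and the generic good-ordinary rank-one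
pairs booked «covered modulo the certificate»). THEOREMS ONLY; the open inputs enter BY NAME (`hPR`
Perrin-Riou 1987 at odd `p`, `hGZK` Gross–Zagier–Kolyvagin, `hmod` modularity where a level is moved);
nothing is booked.

MECHANISM. (i) `ord_{T=0} L_p(f,α,T) ≡ ord_{s=1} L(E,s) (mod 2)` at a good ordinary prime — the TREE
THEOREM `even_order_padicLFunction_iff_even_analyticRank` (Mazur–Tate–Teitelbaum functional equation,
Atkin–Lehner, Hecke, Rohrlich; PROVED, `p = 2` allowed) — so in analytic rank one the `T`-order is ODD
(`ne_zero_and_odd_order_of_analyticRank_eq_one`); (ii) `[T⁰] = 0` (`L(E,1) = 0`, interpolation: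
`analyticRank_le_order_padicLFunction_of_le_two`); (iii) Perrin-Riou 1987 + GZK: `[T¹] L_p ≠ 0 ⟺`
Schneider for THE canonical datum (`Wuthrich2014.coeff_one_padicLFunction_ne_zero_iff_schneider_odd`).
Hence a DEGENERATE canonical height gives order `≥ 2`, so (odd) `≥ 3`, so `[T²] = 0`
(`three_le_order_of_not_schneider`, `coeff_two_eq_zero_of_not_schneider`); contrapositively
**`schneider_of_coeff_two_ne_zero`**: `[T²] ≠ 0 ⇒` Schneider — a second one-coefficient certificate per
pair, next to the lane's `[T¹] ≠ 0` (`X1.schneider_of_coeff_one_ne_zero_odd`,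
`RankOne.Leaf.schneider_of_coeff_one_ne_zero`), and `schneider_iff_coeff_one_ne_zero_or_coeff_two_ne_zero`
(nothing is lost). §4 restates it on x1a's rank-one leaf `X1.RankOne.Leaf` (both GV types; names `leaf_…`).
Source of the idea: planner memo ROUTE-P3-v8-lambda-g10 §1.1 Cor. 3 / (T4) (cell HOME, 2026-08-26), there
«to be typed» for corner A2; the class-free form is this seat's.

What this is NOT: not Schneider's conjecture for any class (the certificate is per pair and semi-decides
non-vanishing exactly like `[T¹] ≠ 0`); not a statement at additive or multiplicative `p` (the parity
transfer is the good-prime functional equation); no value of `#Ш` is touched.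

References: [MazurTateTeitelbaum1986Invent] §I.17–I.18; [PerrinRiou1987] §1.4 Cor. 1.8;
[RohrlichInventiones1984] p. 409; [SteinWuthrich2013] §§3–4; [AtkinLehner1970] Thm. 4.
-/

set_option autoImplicit false

noncomputable section

open scoped Classical MatrixGroups ModularForm

open CongruenceSubgroup WeierstrassCurve Literature.NumberTheory.EllipticCurves
  Literature.NumberTheory.EllipticCurves.ModularForms
  Literature.NumberTheory.EllipticCurves.Rank1Residual
  Summit.BirchSwinnertonDyer.Rank1Residual

-- `Summit.BirchSwinnertonDyer.BirchSwinnertonDyer.…`: the summit and its single sub-problem share a name (D-0017 layout).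
set_option linter.dupNamespace false

namespace Summit.BirchSwinnertonDyer.BirchSwinnertonDyer.Theorems.RankOneCoeffTwoCertificate

variable (W : WeierstrassCurve ℚ) [W.IsElliptic] [W.IsGloballyMinimal] (p : ℕ) [Fact p.Prime]

/-! ## §1. Analytic rank one at a good ordinary prime: `L_p ≠ 0`, `[T⁰] = 0`, `ord_T L_p` odd -/

/-- **In analytic rank one, at a good ordinary prime `p` (any `p`, `2` included): `L_p(f,α,T) ≠ 0` and
`ord_{T=0} L_p(f,α,T)` is ODD** (for the newform `f` of `E` at level `N_E`; `p ∤ N_E` by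
`dvd_conductorNorm_iff_not_hasGoodReductionAtPrime`). The parity transfer
`even_order_padicLFunction_iff_even_analyticRank` with `r_an = 1`; oddness excludes the junk order `⊤`.
No named fact. [cite: MazurTateTeitelbaum1986Invent, §I.17–I.18] -/
theorem ne_zero_and_odd_order_of_analyticRank_eq_one (hord : IsOrdinaryAt W p)
    (han : W.analyticRank = 1) [NeZero (W.conductorNorm ℤ)]
    (f : CuspForm (Gamma0 (W.conductorNorm ℤ)) 2) (hf : IsNewformOf W f) :
    padicLFunction f (unitRoot W p : ℚ_[p]) ≠ 0 ∧
      Odd (padicLFunction f (unitRoot W p : ℚ_[p])).order.toNat := by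
  have hpN : ¬ p ∣ W.conductorNorm ℤ := fun h ↦
    (W.dvd_conductorNorm_iff_not_hasGoodReductionAtPrime p).mp h hord.1
  have hodd : Odd (padicLFunction f (unitRoot W p : ℚ_[p])).order.toNat := by
    rw [← Nat.not_even_iff_odd, even_order_padicLFunction_iff_even_analyticRank W p hf hpN hord, han]
    exact Nat.not_even_one
  refine ⟨fun h0 ↦ ?_, hodd⟩
  rw [h0, PowerSeries.order_zero, ENat.toNat_top] at hodd
  exact absurd hodd (by decide)

/-- **In analytic rank one at a good ordinary prime, `ord_{T=0} L_p(f,α,T) = m` with `m` ODD and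
`m ≥ 1`** (`[T⁰] = 0`: `r_an ≤ ord_T L_p` for `r_an ≤ 2`, `analyticRank_le_order_padicLFunction_of_le_two`).
No named fact. [cite: MazurTateTeitelbaum1986Invent, §I.14 (14.3) and §I.17–I.18] -/
theorem exists_order_eq_odd_of_analyticRank_eq_one (hord : IsOrdinaryAt W p)
    (han : W.analyticRank = 1) [NeZero (W.conductorNorm ℤ)]
    (f : CuspForm (Gamma0 (W.conductorNorm ℤ)) 2) (hf : IsNewformOf W f) :
    ∃ m : ℕ, (padicLFunction f (unitRoot W p : ℚ_[p])).order = m ∧ Odd m ∧ 1 ≤ m := by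
  obtain ⟨hne, hodd⟩ := ne_zero_and_odd_order_of_analyticRank_eq_one W p hord han f hf
  obtain ⟨m, hm⟩ := ENat.ne_top_iff_exists.mp fun h ↦ hne (PowerSeries.order_eq_top.mp h)
  refine ⟨m, hm.symm, ?_, ?_⟩
  · rwa [← hm, ENat.toNat_coe] at hodd
  · rw [← hm, ENat.toNat_coe] at hodd
    exact hodd.pos

/-! ## §2. A degenerate canonical height forces `ord_{T=0} L_p ≥ 3` and `[T²] = 0` -/

/-- **Degenerate canonical height ⇒ `ord_{T=0} L_p(f,α,T) ≥ 3`.** For `W/ℚ` globally minimal elliptic,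
`p ≠ 2` good ordinary, `ord_{s=1} L(E,s) = 1`, a CANONICAL `p`-adic height datum `Dh` violating
Schneider's conjecture, and the newform `f` of `E` at level `N_E`: `[T⁰] = 0` (rank one), `[T¹] = 0`
(Perrin-Riou 1987 + GZK: `Wuthrich2014.coeff_one_padicLFunction_ne_zero_iff_schneider_odd`), and the
order is ODD (§1) — so it is at least `3`; order `2 = rank + 1` is excluded by the sign of the functional
equation. [cite: PerrinRiou1987, §1.4 Cor. 1.8] [cite: MazurTateTeitelbaum1986Invent, §I.17–I.18] -/
theorem three_le_order_of_not_schneider (hPR : perrinRiou_rankOne_leadingTerms_odd)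
    (hGZK : rank_eq_analyticRank_of_analyticRank_le_one) (hp : p ≠ 2) (hord : IsOrdinaryAt W p)
    (han : W.analyticRank = 1) {Dh : PAdicHeightData W p} (hDh : Dh.IsCanonical)
    (hnot : ¬ SchneiderConjecture Dh) [NeZero (W.conductorNorm ℤ)]
    (f : CuspForm (Gamma0 (W.conductorNorm ℤ)) 2) (hf : IsNewformOf W f) :
    (3 : ℕ∞) ≤ (padicLFunction f (unitRoot W p : ℚ_[p])).order := by
  obtain ⟨m, hm, hodd, h1m⟩ := exists_order_eq_odd_of_analyticRank_eq_one W p hord han f hf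
  have h1 : PowerSeries.coeff 1 (padicLFunction f (unitRoot W p : ℚ_[p])) = 0 := by
    by_contra h1
    exact hnot ((Wuthrich2014.coeff_one_padicLFunction_ne_zero_iff_schneider_odd hPR hGZK W p hp hord
      han Dh hDh f hf).mp h1)
  have h2m : 2 ≤ m := by
    by_contra hlt
    have hm1 : m = 1 := by omega
    have hc : PowerSeries.coeff m (padicLFunction f (unitRoot W p : ℚ_[p])) ≠ 0 :=
      (PowerSeries.order_eq_nat.mp hm).1
    rw [hm1] at hc
    exact hc h1
  rw [hm]
  obtain ⟨k, rfl⟩ := hodd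
  exact_mod_cast (show 3 ≤ 2 * k + 1 by omega)

/-- **Degenerate canonical height ⇒ `[T²] L_p(f,α,T) = 0`** (indeed `[T^k] = 0` for `k < 3`).
[cite: PerrinRiou1987, §1.4 Cor. 1.8] [cite: MazurTateTeitelbaum1986Invent, §I.17–I.18] -/
theorem coeff_eq_zero_of_lt_three_of_not_schneider (hPR : perrinRiou_rankOne_leadingTerms_odd)
    (hGZK : rank_eq_analyticRank_of_analyticRank_le_one) (hp : p ≠ 2) (hord : IsOrdinaryAt W p)
    (han : W.analyticRank = 1) {Dh : PAdicHeightData W p} (hDh : Dh.IsCanonical)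
    (hnot : ¬ SchneiderConjecture Dh) [NeZero (W.conductorNorm ℤ)]
    (f : CuspForm (Gamma0 (W.conductorNorm ℤ)) 2) (hf : IsNewformOf W f) {k : ℕ} (hk : k < 3) :
    PowerSeries.coeff k (padicLFunction f (unitRoot W p : ℚ_[p])) = 0 :=
  PowerSeries.coeff_of_lt_order k (lt_of_lt_of_le (by exact_mod_cast hk)
    (three_le_order_of_not_schneider W p hPR hGZK hp hord han hDh hnot f hf))

/-- **`p`-adic BSD reading: a degenerate canonical height forces `ord_{T=0} L_p ≥ rank E(ℚ) + 2`**
(GZK: `rank = r_an = 1`), i.e. clause (i) of the Mazur–Tate–Teitelbaum conjecture then fails by at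
least two. [cite: MazurTateTeitelbaum1986Invent, §II.10 Conj. BSD(p) (i)] [cite: PerrinRiou1987, §1.4 Cor. 1.8] -/
theorem rank_add_two_le_order_of_not_schneider (hPR : perrinRiou_rankOne_leadingTerms_odd)
    (hGZK : rank_eq_analyticRank_of_analyticRank_le_one) (hp : p ≠ 2) (hord : IsOrdinaryAt W p)
    (han : W.analyticRank = 1) {Dh : PAdicHeightData W p} (hDh : Dh.IsCanonical)
    (hnot : ¬ SchneiderConjecture Dh) [NeZero (W.conductorNorm ℤ)]
    (f : CuspForm (Gamma0 (W.conductorNorm ℤ)) 2) (hf : IsNewformOf W f) :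
    ((W.mordellWeilRank + 2 : ℕ) : ℕ∞) ≤ (padicLFunction f (unitRoot W p : ℚ_[p])).order := by
  have hrank : W.mordellWeilRank = 1 := (hGZK W han.le).1.trans han
  rw [hrank]
  exact three_le_order_of_not_schneider W p hPR hGZK hp hord han hDh hnot f hf

/-! ## §3. The parity-squeezed certificate -/

/-- **THE PARITY-SQUEEZED CERTIFICATE (class-free).** For `W/ℚ` globally minimal elliptic, `p ≠ 2` good
ordinary, `ord_{s=1} L(E,s) = 1`, and the newform `f` of `E` at level `N_E`: if `[T²] L_p(f,α,T) ≠ 0`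
then EVERY canonical `p`-adic height datum satisfies Schneider's conjecture (`Reg_p ≠ 0`) — granted
Perrin-Riou 1987 at odd `p` (`hPR`) and GZK (`hGZK`). Contrapositive of
`coeff_eq_zero_of_lt_three_of_not_schneider`. It can succeed only where `ord_T L_p = 1`, like the
`[T¹]`-certificate, but tests a DIFFERENT `p`-adic number. [cite: PerrinRiou1987, §1.4 Cor. 1.8]
[cite: MazurTateTeitelbaum1986Invent, §I.17–I.18] [cite: SteinWuthrich2013, §§3–4] -/
theorem schneider_of_coeff_two_ne_zero (hPR : perrinRiou_rankOne_leadingTerms_odd)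
    (hGZK : rank_eq_analyticRank_of_analyticRank_le_one) (hp : p ≠ 2) (hord : IsOrdinaryAt W p)
    (han : W.analyticRank = 1) [NeZero (W.conductorNorm ℤ)]
    (f : CuspForm (Gamma0 (W.conductorNorm ℤ)) 2) (hf : IsNewformOf W f)
    (h2 : PowerSeries.coeff 2 (padicLFunction f (unitRoot W p : ℚ_[p])) ≠ 0) :
    ∀ Dh : PAdicHeightData W p, Dh.IsCanonical → SchneiderConjecture Dh := by
  intro Dh hDh
  by_contra hnot
  exact h2 (coeff_eq_zero_of_lt_three_of_not_schneider W p hPR hGZK hp hord han hDh hnot f hf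
    (by norm_num))

/-- **The weakened binder «`[T¹] ≠ 0 ∨ [T²] ≠ 0` ⇒ Schneider»** (class-free; newform at level `N_E`;
Perrin-Riou 1987 + GZK). [cite: PerrinRiou1987, §1.4 Cor. 1.8] [cite: MazurTateTeitelbaum1986Invent, §I.17–I.18] -/
theorem schneider_of_coeff_one_ne_zero_or_coeff_two_ne_zero (hPR : perrinRiou_rankOne_leadingTerms_odd)
    (hGZK : rank_eq_analyticRank_of_analyticRank_le_one) (hp : p ≠ 2) (hord : IsOrdinaryAt W p)
    (han : W.analyticRank = 1) [NeZero (W.conductorNorm ℤ)]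
    (f : CuspForm (Gamma0 (W.conductorNorm ℤ)) 2) (hf : IsNewformOf W f)
    (h12 : PowerSeries.coeff 1 (padicLFunction f (unitRoot W p : ℚ_[p])) ≠ 0 ∨
      PowerSeries.coeff 2 (padicLFunction f (unitRoot W p : ℚ_[p])) ≠ 0) :
    ∀ Dh : PAdicHeightData W p, Dh.IsCanonical → SchneiderConjecture Dh := by
  rcases h12 with h1 | h2
  · intro Dh hDh
    exact (Wuthrich2014.coeff_one_padicLFunction_ne_zero_iff_schneider_odd hPR hGZK W p hp hord han Dh
      hDh f hf).mp h1
  · exact schneider_of_coeff_two_ne_zero W p hPR hGZK hp hord han f hf h2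

/-- **Nothing is lost: Schneider ⟺ `[T¹] ≠ 0 ∨ [T²] ≠ 0`** for a canonical datum (class-free; newform at
level `N_E`; Perrin-Riou 1987 + GZK; (→) is `[T¹] ≠ 0` alone). [cite: PerrinRiou1987, §1.4 Cor. 1.8]
[cite: MazurTateTeitelbaum1986Invent, §I.17–I.18] -/
theorem schneider_iff_coeff_one_ne_zero_or_coeff_two_ne_zero (hPR : perrinRiou_rankOne_leadingTerms_odd)
    (hGZK : rank_eq_analyticRank_of_analyticRank_le_one) (hp : p ≠ 2) (hord : IsOrdinaryAt W p)
    (han : W.analyticRank = 1) (Dh : PAdicHeightData W p) (hDh : Dh.IsCanonical)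
    [NeZero (W.conductorNorm ℤ)] (f : CuspForm (Gamma0 (W.conductorNorm ℤ)) 2) (hf : IsNewformOf W f) :
    SchneiderConjecture Dh ↔
      (PowerSeries.coeff 1 (padicLFunction f (unitRoot W p : ℚ_[p])) ≠ 0 ∨
        PowerSeries.coeff 2 (padicLFunction f (unitRoot W p : ℚ_[p])) ≠ 0) :=
  ⟨fun hSch ↦ Or.inl ((Wuthrich2014.coeff_one_padicLFunction_ne_zero_iff_schneider_odd hPR hGZK W p hp
      hord han Dh hDh f hf).mpr hSch),
    fun h12 ↦ schneider_of_coeff_one_ne_zero_or_coeff_two_ne_zero W p hPR hGZK hp hord han f hf h12 Dh hDh⟩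

/-- **The certificate at ANY level** `N` of the newform (as the lane phrases certificates), granted
modularity in the form `exists_isNewformOf` (`hmod`; then `N = N_E`,
`IsNewformOf.level_eq_conductorNorm_of_exists_isNewformOf`). [cite: PerrinRiou1987, §1.4 Cor. 1.8]
[cite: AtkinLehner1970, Thm. 4] -/
theorem schneider_of_coeff_two_ne_zero_of_level (hPR : perrinRiou_rankOne_leadingTerms_odd)
    (hGZK : rank_eq_analyticRank_of_analyticRank_le_one) (hmod : exists_isNewformOf) (hp : p ≠ 2)
    (hord : IsOrdinaryAt W p) (han : W.analyticRank = 1) {N : ℕ} [NeZero N]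
    (f : CuspForm (Gamma0 N) 2) (hf : IsNewformOf W f)
    (h2 : PowerSeries.coeff 2 (padicLFunction f (unitRoot W p : ℚ_[p])) ≠ 0) :
    ∀ Dh : PAdicHeightData W p, Dh.IsCanonical → SchneiderConjecture Dh := by
  obtain rfl : N = W.conductorNorm ℤ := IsNewformOf.level_eq_conductorNorm_of_exists_isNewformOf hmod hf
  exact schneider_of_coeff_two_ne_zero W p hPR hGZK hp hord han f hf h2

/-- **Non-vacuity: the certificate certifies THE canonical datum, which exists** at every odd good
ordinary prime (`X1.PadicSigmaThree.exists_isCanonical_odd`, a tree theorem: the Mazur–Tate `σ` at odd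
`p`): under `[T²] ≠ 0` there IS a canonical datum and it is non-degenerate.
[cite: MazurSteinTate2006, Thm. 1.3] [cite: PerrinRiou1987, §1.4 Cor. 1.8] -/
theorem exists_isCanonical_schneider_of_coeff_two_ne_zero (hPR : perrinRiou_rankOne_leadingTerms_odd)
    (hGZK : rank_eq_analyticRank_of_analyticRank_le_one) (hp : p ≠ 2) (hord : IsOrdinaryAt W p)
    (han : W.analyticRank = 1) [NeZero (W.conductorNorm ℤ)]
    (f : CuspForm (Gamma0 (W.conductorNorm ℤ)) 2) (hf : IsNewformOf W f)
    (h2 : PowerSeries.coeff 2 (padicLFunction f (unitRoot W p : ℚ_[p])) ≠ 0) :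
    ∃ Dh : PAdicHeightData W p, Dh.IsCanonical ∧ SchneiderConjecture Dh := by
  obtain ⟨Dh, hDh⟩ := X1.PadicSigmaThree.exists_isCanonical_odd W p hp hord.1 hord.2
  exact ⟨Dh, hDh, schneider_of_coeff_two_ne_zero W p hPR hGZK hp hord han f hf h2 Dh hDh⟩

/-! ## §4. On x1a's rank-one leaf of class X1 (both Greenberg–Vatsal types: README rows A1 and A2) -/

/-- **On the rank-one leaf `X1.RankOne.Leaf W p` (`p > 2`, `E[p]` reducible, good anomalous, `r_an = 1`;
BOTH parity types): `[T²] L_p(f,α,T) ≠ 0 ⇒` Schneider for every canonical datum** — the companion of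
`RankOne.Leaf.schneider_of_coeff_one_ne_zero`, to be fed to the leaf's roads
(`RankOne.Leaf.mazurMainConjecture_and_bsdp_of_shaAn_unit_of_schneider`, the type-B α-road
`X1.bsdp_of_typeBRankOne_of_schneider`, …) in place of the `[T¹]`-certificate.
[cite: PerrinRiou1987, §1.4 Cor. 1.8] [cite: MazurTateTeitelbaum1986Invent, §I.17–I.18] -/
theorem leaf_schneider_of_coeff_two_ne_zero
    {W : WeierstrassCurve ℚ} [W.IsElliptic] [W.IsGloballyMinimal] {p : ℕ} [Fact p.Prime]
    (hPR : perrinRiou_rankOne_leadingTerms_odd) (hGZK : rank_eq_analyticRank_of_analyticRank_le_one)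
    (hL : X1.RankOne.Leaf W p) [NeZero (W.conductorNorm ℤ)]
    (f : CuspForm (Gamma0 (W.conductorNorm ℤ)) 2) (hf : IsNewformOf W f)
    (h2 : PowerSeries.coeff 2 (padicLFunction f (unitRoot W p : ℚ_[p])) ≠ 0) :
    ∀ Dh : PAdicHeightData W p, Dh.IsCanonical → SchneiderConjecture Dh :=
  schneider_of_coeff_two_ne_zero W p hPR hGZK hL.two_ne hL.isOrdinaryAt hL.analyticRank_eq_one f hf h2

/-- **On the rank-one leaf a degenerate canonical height forces `ord_{T=0} L_p ≥ 3`** (both GV types).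
[cite: PerrinRiou1987, §1.4 Cor. 1.8] [cite: MazurTateTeitelbaum1986Invent, §I.17–I.18] -/
theorem leaf_three_le_order_of_not_schneider
    {W : WeierstrassCurve ℚ} [W.IsElliptic] [W.IsGloballyMinimal] {p : ℕ} [Fact p.Prime]
    (hPR : perrinRiou_rankOne_leadingTerms_odd) (hGZK : rank_eq_analyticRank_of_analyticRank_le_one)
    (hL : X1.RankOne.Leaf W p) {Dh : PAdicHeightData W p} (hDh : Dh.IsCanonical)
    (hnot : ¬ SchneiderConjecture Dh) [NeZero (W.conductorNorm ℤ)]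
    (f : CuspForm (Gamma0 (W.conductorNorm ℤ)) 2) (hf : IsNewformOf W f) :
    (3 : ℕ∞) ≤ (padicLFunction f (unitRoot W p : ℚ_[p])).order :=
  three_le_order_of_not_schneider W p hPR hGZK hL.two_ne hL.isOrdinaryAt hL.analyticRank_eq_one hDh hnot
    f hf

end Summit.BirchSwinnertonDyer.BirchSwinnertonDyer.Theorems.RankOneCoeffTwoCertificate

end
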